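import Literature.AlgebraicGeometry.GroupSchemes.IdealTorsionCoprimeSplittingRank
import HarnessLib

/-!
# The rank of a kernel killed by two coprime ideals: `rk Γ(Ker q) = rk Γ(Ker q ∩ A[𝔞]) · rk Γ(Ker q ∩ A[𝔟])`, both factors REALISATION-FREE
# ([Tate1997FiniteFlatGroupSchemes] §(3.7); [Tate1967] §2.2; [Neukirch1999] Ch. I §3 (3.6))

Topic `Literature/AlgebraicGeometry/GroupSchemes`; namespace `Literature.AlgebraicGeometry.GroupSchemes.IdealTorsionCoprimeSplitting` (continues ★ p849988
`IdealTorsionCoprimeSplittingRank`: there the closed subgroups `K[𝔞]`, `K[𝔟]` of `K` are GIVEN with their points laws relative to an action `βK` ON `K`; here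
`K := Ker q` for a homomorphism `q : A → B` out of a group scheme `A` with an `O`-action `ι`, the action on `Ker q` is the restricted one, `K[𝔞]` is BUILT
(`Ker (βK e₂)` for a CRT element), and `K[𝔟]` is ANY monomorphism `ζ : Z ↪ A` reading «`𝔟`-torsion ∧ killed by `q`» — the shape in which consumers state
ranks realisation-free).  THEOREMS ONLY (no definition, no named fact, no instance, no notation, no `sorry`).  Cell `hodgecm-mathlib` (D-0151), P6 «MOD
programme» (crux hLiu418 = stmt-HodgeConjecture-24832, `--supports`, count-neutral), half-A line L3 (W5 junction `stub_ROOFGEO`; GAP-2 «W-instantiation at x̄»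
`hlaw_w_sch₀Of`, binder `hrkN` «`rk Γ(Ker q̄ ∩ A_x̄[𝔭_w]) = q`», LA3-plan (g2) ruling (W-γ) 2026-09-02T07:38:51Z; LA3-p03 (g3)).  HONEST LABEL: HC_CM is proved only
modulo the 2 remaining named inputs (hLiu418 24832, h413 24833) until rung 0 closes; this file is generic and discharges none of them.

THE MATHEMATICS.  `k` a field, `A`, `B` group schemes over `k`, `q : A → B` a homomorphism, `ι : O → End(A)` an action of a commutative ring by homomorphisms
(`ι 1 = id`, `ι(a+b) = ι a · ι b`, `ι(ab) = ι b ≫ ι a`), and `βK : O → End(Ker q)` homomorphisms with `βK a ≫ ι_{Ker q} = ι_{Ker q} ≫ ι a` (the restricted action;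
it exists as soon as `Ker q` is `ι`-stable, §1).  §1 `comp_comp_eq_one_of_exists_comp_eq`: WEAK equivariance «`ι a ≫ q = q ≫ b` for SOME endomorphism `b` of `B`»
already makes `Ker q` stable — evaluating at the unit point gives `1 ≫ b = 1`.  §2: the laws of `βK` (unital, additive, anti-multiplicative, `𝔞𝔟` kills) follow
from those of `ι` by cancelling the monomorphism `ι_{Ker q}`.  §3 HEAD `finrank_alg_ker_eq_mul`: if `𝔞 + 𝔟 = (1)`, `𝔞𝔟` kills `Ker q` (on points), `Ker q` is
affine with `Γ` finite, every monomorphism reading «`𝔞`-torsion ∧ `q`-killed» has rank `m`, and `ζ : Z ↪ A` reads «`𝔟`-torsion ∧ `q`-killed», then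
`rk Γ(Ker q) = m · rk Γ(Z)`: CRT elements `e ≡ 1 (𝔞), e ∈ 𝔟` and `e₂ ≡ 1 (𝔟), e₂ ∈ 𝔞` ([Neukirch1999] (3.6)); `Ker (βK e₂) ↪ Ker q` is the `𝔞`-torsion
(★ `comp_crt_eq_one_iff`), a closed subgroup, and `Ker (βK e₂) ↪ Ker q ↪ A` reads «`𝔞`-torsion ∧ `q`-killed», so has rank `m`; `ζ` lifts to a monomorphism
`Z ↪ Ker q` reading the `𝔟`-torsion; ★ `finrank_alg_eq_mul_of_crt` ([Tate1997FiniteFlatGroupSchemes] §(3.7): `K ≅ K[𝔞] × K[𝔟]`, ranks multiply).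

* §1 `comp_comp_eq_one_of_exists_comp_eq`;
* §2 `restrict_one`, `restrict_add`, `restrict_mul`, `restrict_eq_one_of_mem_mul`;
* §3 HEAD **`finrank_alg_ker_eq_mul`**.

## References
* [Tate1997FiniteFlatGroupSchemes] J. Tate, *Finite flat group schemes*, in: Modular Forms and Fermat's Last Theorem (1997) — §(3.7) (p. 146).
* [Tate1967] J. T. Tate, *p-divisible groups* (1967) — §2.2.
* [Neukirch1999] J. Neukirch, *Algebraic Number Theory* (1999) — Ch. I §3 (3.6).
* [GortzWedhorn2020] U. Görtz, T. Wedhorn, *Algebraic Geometry I*, 2nd ed. (2020) — Definition 4.45 (2) (p. 117).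
-/

set_option autoImplicit false

-- Mathlib's `Over`/`Scheme` APIs are stated across semireducible wrappers (as in the ★ `GroupSchemes/*` files).
set_option backward.isDefEq.respectTransparency false

noncomputable section

universe u v

open CategoryTheory CategoryTheory.Limits AlgebraicGeometry MonoidalCategory CartesianMonoidalCategory
open scoped MonObj

namespace Literature.AlgebraicGeometry.GroupSchemes

namespace IdealTorsionCoprimeSplitting

open Literature.AlgebraicGeometry.Motives GroupSchemeKernel AffineGroupScheme

variable {k : Type u} [Field k] {O : Type v} [CommRing O]
variable {A B : SchemeOver k} [GrpObj A] [GrpObj B] (act : O → (A ⟶ A)) [∀ a, IsMonHom (act a)] (q : A ⟶ B) [IsMonHom q]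

/-! ## §1 Weak equivariance makes `Ker q` stable -/

omit [CommRing O] in
/-- **`Ker q` IS `ι`-STABLE UNDER WEAK EQUIVARIANCE**: if `ι a ≫ q = q ≫ b` for some endomorphism `b` of `B` (no hypothesis on `b`) and `ι a` is a homomorphism,
then every `q`-killed point `x` has `x ≫ ι a` `q`-killed — evaluating the relation at the unit point gives `1 ≫ b = 1`.
[cite: GortzWedhorn2020, Definition 4.45 (2) (p. 117)] [cite: Tate1967, §2.2] -/
theorem comp_comp_eq_one_of_exists_comp_eq {a : O} (hr4 : ∃ b : B ⟶ B, act a ≫ q = q ≫ b)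
    ⦃T : SchemeOver k⦄ (x : T ⟶ A) (hx : x ≫ q = 1) : (x ≫ act a) ≫ q = 1 := by
  obtain ⟨b, hb⟩ := hr4
  have h1 : (1 : T ⟶ B) ≫ b = 1 := by
    have h := congrArg (fun φ => (1 : T ⟶ A) ≫ φ) hb
    simp only [MonObj.one_comp_assoc] at h
    rw [MonObj.one_comp] at h
    exact h.symm
  rw [Category.assoc, hb, reassoc_of% hx, h1]

/-! ## §2 The laws of the restricted action on `Ker q` -/

section Restrict

variable (βK : O → (ker q ⟶ ker q)) (hβK : ∀ a, βK a ≫ kerι q = kerι q ≫ act a)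

omit [GrpObj A] [∀ a, IsMonHom (act a)] [IsMonHom q] in
include hβK in
/-- `βK 1 = 𝟙` from `ι 1 = 𝟙` (cancel the monomorphism `ι_{Ker q}`). [cite: Tate1967, §2.2] -/
theorem restrict_one (h1 : act 1 = 𝟙 A) : βK 1 = 𝟙 (ker q) := by
  haveI := mono_kerι q
  rw [← cancel_mono (kerι q), hβK, h1, Category.comp_id, Category.id_comp]

omit [∀ a, IsMonHom (act a)] in
include hβK in
/-- `βK (a + b) = βK a · βK b` from `ι (a + b) = ι a · ι b` (`ι_{Ker q}` is a monomorphic homomorphism). [cite: Tate1967, §2.2] -/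
theorem restrict_add (hadd : ∀ a b, act (a + b) = act a * act b) (a b : O) : βK (a + b) = βK a * βK b := by
  haveI := mono_kerι q
  rw [← cancel_mono (kerι q), hβK, hadd, MonObj.comp_mul, MonObj.mul_comp, hβK, hβK]

omit [GrpObj A] [∀ a, IsMonHom (act a)] [IsMonHom q] in
include hβK in
/-- `βK (a b) = βK b ≫ βK a` from `ι (a b) = ι b ≫ ι a`. [cite: Tate1967, §2.2] -/
theorem restrict_mul (hmul : ∀ a b, act (a * b) = act b ≫ act a) (a b : O) : βK (a * b) = βK b ≫ βK a := by
  haveI := mono_kerι q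
  rw [← cancel_mono (kerι q), Category.assoc, hβK, hβK, reassoc_of% (hβK b), hmul]

omit [∀ a, IsMonHom (act a)] in
include hβK in
/-- `βK c = 1` for `c ∈ 𝔞𝔟` when `𝔞𝔟` kills the `q`-killed points. [cite: Tate1997FiniteFlatGroupSchemes, §(3.7) (p. 146)] -/
theorem restrict_eq_one_of_mem_mul {𝔞 𝔟 : Ideal O} (hkq : ∀ ⦃T : SchemeOver k⦄ (x : T ⟶ A), x ≫ q = 1 → ∀ c ∈ 𝔞 * 𝔟, x ≫ act c = 1)
    (c : O) (hc : c ∈ 𝔞 * 𝔟) : βK c = 1 := by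
  haveI := mono_kerι q
  rw [← cancel_mono (kerι q), hβK, MonObj.one_comp]
  exact hkq _ (kerι_comp q) c hc

end Restrict

/-! ## §3 The head: `rk Γ(Ker q) = m · rk Γ(Z)` -/

omit [∀ a, IsMonHom (act a)] in
/-- **THE RANK OF A KERNEL KILLED BY TWO COPRIME IDEALS, REALISATION-FREE FACTORS.**  `q : A → B` a homomorphism of `k`-group schemes, `ι : O → End A` an action by
homomorphisms (unital, additive, anti-multiplicative), `βK` the restricted action on `Ker q` (`βK a ≫ ι_{Ker q} = ι_{Ker q} ≫ ι a`, by homomorphisms), `𝔞 + 𝔟 = (1)` with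
`𝔞𝔟` killing the `q`-killed points, `Ker q` affine with `Γ(Ker q)` finite over `k`.  If EVERY monomorphism `ζ' : Z' ↪ A` whose `T`-points are «`𝔞`-torsion ∧ killed by
`q`» has `dim_k Γ(Z') = m`, then every monomorphism `ζ : Z ↪ A` whose `T`-points are «`𝔟`-torsion ∧ killed by `q`» satisfies `dim_k Γ(Ker q) = m · dim_k Γ(Z)`.
PROOF: CRT elements `e ≡ 1 (𝔞), e ∈ 𝔟` and `e₂ ≡ 1 (𝔟), e₂ ∈ 𝔞` (★ `exists_crt_of_sup_eq_top`); `Ker (βK e₂) ↪ Ker q` is the `𝔞`-torsion of `Ker q` (★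
`comp_crt_eq_one_iff`), a closed subgroup (★ `isAffine_ker_left`), and composed with `ι_{Ker q}` it reads «`𝔞`-torsion ∧ `q`-killed», so its rank is `m`; `ζ` lifts
along `ι_{Ker q}` to a monomorphism reading the `𝔟`-torsion of `Ker q`; ★ `finrank_alg_eq_mul_of_crt`. [cite: Tate1997FiniteFlatGroupSchemes, §(3.7) (p. 146)]
[cite: Tate1967, §2.2] [cite: Neukirch1999, Ch. I §3 (3.6)] [cite: GortzWedhorn2020, Definition 4.45 (2) (p. 117)] -/
theorem finrank_alg_ker_eq_mul (βK : O → (ker q ⟶ ker q)) [∀ a, IsMonHom (βK a)] (hβK : ∀ a, βK a ≫ kerι q = kerι q ≫ act a)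
    (h1 : act 1 = 𝟙 A) (hadd : ∀ a b, act (a + b) = act a * act b) (hmul : ∀ a b, act (a * b) = act b ≫ act a)
    {𝔞 𝔟 : Ideal O} (h𝔞𝔟 : 𝔞 ⊔ 𝔟 = ⊤) (hkq : ∀ ⦃T : SchemeOver k⦄ (x : T ⟶ A), x ≫ q = 1 → ∀ c ∈ 𝔞 * 𝔟, x ≫ act c = 1)
    [IsAffine (ker q).left] [Module.Finite k (Alg (ker q))] {m : ℕ}
    (hrk𝔞 : ∀ {Z' : SchemeOver k} (ζ' : Z' ⟶ A) [Mono ζ'],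
      (∀ ⦃T : SchemeOver k⦄ (x : T ⟶ A), (∃ z : T ⟶ Z', z ≫ ζ' = x) ↔ (∀ a ∈ 𝔞, x ≫ act a = 1) ∧ x ≫ q = 1) →
      Module.finrank k (Alg Z') = m)
    {Z : SchemeOver k} (ζ : Z ⟶ A) [Mono ζ]
    (hZ : ∀ ⦃T : SchemeOver k⦄ (x : T ⟶ A), (∃ z : T ⟶ Z, z ≫ ζ = x) ↔ (∀ b ∈ 𝔟, x ≫ act b = 1) ∧ x ≫ q = 1) :
    Module.finrank k (Alg (ker q)) = m * Module.finrank k (Alg Z) := by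
  haveI := mono_kerι q
  -- §2: the laws of `βK`
  have hβ1 := restrict_one act q βK hβK h1
  have hβadd := restrict_add act q βK hβK hadd
  have hβmul := restrict_mul act q βK hβK hmul
  have hk : ∀ c ∈ 𝔞 * 𝔟, βK c = 1 := restrict_eq_one_of_mem_mul act q βK hβK hkq
  have hk' : ∀ c ∈ 𝔟 * 𝔞, βK c = 1 := fun c hc => hk c (mul_comm 𝔟 𝔞 ▸ hc)
  -- CRT elements
  obtain ⟨e, he𝔞, he𝔟⟩ := exists_crt_of_sup_eq_top h𝔞𝔟
  obtain ⟨e₂, he₂𝔟, he₂𝔞⟩ := exists_crt_of_sup_eq_top ((sup_comm 𝔞 𝔟).symm.trans h𝔞𝔟)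
  -- `K[𝔞] := Ker (βK e₂)`, a closed subgroup of `Ker q` reading the `𝔞`-torsion
  haveI := mono_kerι (βK e₂)
  haveI : IsAffine (ker (βK e₂)).left := isAffine_ker_left (βK e₂)
  have h𝔞 : ∀ ⦃T : SchemeOver k⦄ (x : T ⟶ ker q), (∃ s : T ⟶ ker (βK e₂), s ≫ kerι (βK e₂) = x) ↔ ∀ a ∈ 𝔞, x ≫ βK a = 1 := by
    intro T x
    rw [← comp_crt_eq_one_iff βK hβadd hβmul hk' he₂𝔟 he₂𝔞 x]
    exact ⟨fun ⟨s, hs⟩ => by rw [← hs, Category.assoc, kerι_comp, MonObj.comp_one], fun hx => ⟨kerLift x hx, kerLift_ι x hx⟩⟩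
  -- `K[𝔟] := Z`, lifted along `ι_{Ker q}`
  have hζq : ζ ≫ q = 1 := ((hZ ζ).1 ⟨𝟙 Z, Category.id_comp ζ⟩).2
  haveI : Mono (kerLift ζ hζq) := mono_of_mono_fac (kerLift_ι ζ hζq)
  have h𝔟 : ∀ ⦃T : SchemeOver k⦄ (x : T ⟶ ker q), (∃ s : T ⟶ Z, s ≫ kerLift ζ hζq = x) ↔ ∀ b ∈ 𝔟, x ≫ βK b = 1 := by
    intro T x
    constructor
    · rintro ⟨s, rfl⟩ b hb
      rw [← cancel_mono (kerι q), MonObj.one_comp, Category.assoc, Category.assoc, hβK, kerLift_ι_assoc, ← Category.assoc]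
      exact ((hZ (s ≫ ζ)).1 ⟨s, rfl⟩).1 b hb
    · intro hx
      have hxq : (x ≫ kerι q) ≫ q = 1 := by rw [Category.assoc, kerι_comp, MonObj.comp_one]
      obtain ⟨s, hs⟩ := (hZ (x ≫ kerι q)).2
        ⟨fun b hb => by rw [Category.assoc, ← hβK, ← Category.assoc, hx b hb, MonObj.one_comp], hxq⟩
      exact ⟨s, by rw [← cancel_mono (kerι q), Category.assoc, kerLift_ι, hs]⟩
  -- ★ CRT splitting of the rank
  have hsplit := finrank_alg_eq_mul_of_crt βK (kerι (βK e₂)) h𝔞 (kerLift ζ hζq) h𝔟 hβ1 hβadd hβmul hk he𝔞 he𝔟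
  -- the rank of `K[𝔞]`: `Ker (βK e₂) ↪ Ker q ↪ A` reads «`𝔞`-torsion ∧ `q`-killed»
  haveI : Mono (kerι (βK e₂) ≫ kerι q) := mono_comp _ _
  have hlaw𝔞 : ∀ ⦃T : SchemeOver k⦄ (x : T ⟶ A),
      (∃ z : T ⟶ ker (βK e₂), z ≫ (kerι (βK e₂) ≫ kerι q) = x) ↔ (∀ a ∈ 𝔞, x ≫ act a = 1) ∧ x ≫ q = 1 := by
    intro T x
    constructor
    · rintro ⟨z, rfl⟩
      refine ⟨fun a ha => ?_, by rw [Category.assoc, Category.assoc, kerι_comp, MonObj.comp_one, MonObj.comp_one]⟩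
      have hz : (z ≫ kerι (βK e₂)) ≫ βK a = 1 := (h𝔞 _).1 ⟨z, rfl⟩ a ha
      rw [← Category.assoc, Category.assoc _ (kerι q), ← hβK, ← Category.assoc, hz, MonObj.one_comp]
    · rintro ⟨hxa, hxq⟩
      obtain ⟨s, hs⟩ := (h𝔞 (kerLift x hxq)).2 fun a ha => by
        rw [← cancel_mono (kerι q), Category.assoc, hβK, kerLift_ι_assoc, MonObj.one_comp]; exact hxa a ha
      exact ⟨s, by rw [← Category.assoc, hs, kerLift_ι]⟩
  rw [hsplit, hrk𝔞 (kerι (βK e₂) ≫ kerι q) hlaw𝔞]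

end IdealTorsionCoprimeSplitting

end Literature.AlgebraicGeometry.GroupSchemes

end
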